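import Summits.Ventures.PercRepro.PuncturedLYMTwoCoHypPos

/-!
# PercRepro — TWO DISJOINT CO-HYPERPLANES, PART 7b: POSITIVITY OF THE EXPLICIT FLOW, II — THE LAYER `+R` WEIGHTS
AND THE ASSEMBLY (p10, gen 35)

Arithmetic only, continuing part 7.
* **`layer1_R_nonneg`** — on the layer-1 row `(m₁ − 1, b)` (`1 ≤ b ≤ m₂ − 2`) the `+R` weight
  `supR (m₁ − 1) b + γ_b` is nonnegative: by the key estimate the loss `−γ_b` is at most `1/((n − j)·m₁·C(m₂, b))`,
  against the margin `1 − f¹_{m₁−1} − f²_b ≥ 1 − f¹_{m₁−1} − δ₂ − 1/C(m₂, b)` with `f¹_{m₁−1} ≤ (j + 1 − m₁)/(m₁·j)`,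
  `δ₂ ≤ 1/8` and `C(m₂, b) ≥ m₂`: for `m₁ ≥ 3` the margin is `≥ 1 − 1/3 − 1/8 − (4/3)/3 > 0`; for `m₁ = 2` (which forces
  `m₂ = j`) it is `≥ 7/8 − (j + 2)/(2j) ≥ 0`;
* **`w_nonneg`** — every weight is nonnegative on `a < m₁`, `b < m₂` (layer 2 by the mirror symmetry)
— the last hypothesis of `puncturedNMP_two_of_seq`.  Nothing here asserts (SP).
-/

namespace PercRepro.PuncturedLYM

open Finset

/-- **The layer-1 `+R` weight is nonnegative**: `supR (m₁ − 1) b + γ_b ≥ 0` for `1 ≤ b`, `b + 2 ≤ m₂`. -/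
theorem layer1_R_nonneg {n j m₁ m₂ b : ℕ} (hm₁ : 2 ≤ m₁) (hm₁j : m₁ ≤ j) (hm₂ : 2 ≤ m₂) (hm₂j : m₂ ≤ j)
    (hbig : j + 2 ≤ m₁ + m₂) (hn : 2 * j + 1 ≤ n) (hb1 : 1 ≤ b) (hb : b + 2 ≤ m₂) :
    0 ≤ supR n j m₁ m₂ (m₁ - 1) b + cGamma n j m₁ m₂ b := by
  have hr : (0 : ℚ) < ((n - j : ℕ) : ℚ) := by
    have : 1 ≤ n - j := by omega
    exact_mod_cast this
  have hm₁q : (2 : ℚ) ≤ m₁ := by exact_mod_cast hm₁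
  have hm₂q : (2 : ℚ) ≤ m₂ := by exact_mod_cast hm₂
  have hm₁0 : (0 : ℚ) < m₁ := by linarith
  -- the pieces
  have hsup := supR_eq (m₁ := m₁) (m₂ := m₂) (a := m₁ - 1) (b := b) hn
  set G := (b : ℚ) * coF n j m₂ (b - 1) / ((m₂ + 1 - b : ℕ) : ℚ) with hG
  have hγ : cGamma n j m₁ m₂ b = -(G / (m₁ : ℚ)) / ((n - j : ℕ) : ℚ) := by
    unfold cGamma
    rw [hG]
    have : ((m₂ + 1 - b : ℕ) : ℚ) ≠ 0 := by
      have : 1 ≤ m₂ + 1 - b := by omega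
      exact_mod_cast (show m₂ + 1 - b ≠ 0 by omega)
    field_simp
  have hGle := coF_pred_bound (m := m₂) (b := b) (by omega) hm₂j hn hb1 (by omega)
  have hG0 : 0 ≤ G := by
    rw [hG]
    apply div_nonneg (mul_nonneg (by positivity) (coF_nonneg (by omega) hm₂j hn (by omega))) (by positivity)
  have hFb := coF_le_coDel_add (m := m₂) (c := b) (by omega) hm₂j hn (by omega)
  have hF1 := coF_top_le (m := m₁) (by omega) hm₁j hn
  have hF10 := coF_nonneg (m := m₁) (c := m₁ - 1) (by omega) hm₁j hn (by omega)
  have hC : (m₂ : ℚ) ≤ ((m₂.choose b : ℕ) : ℚ) := by exact_mod_cast le_choose_of_one_le_of_lt hb1 (by omega)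
  have hCpos : (0 : ℚ) < ((m₂.choose b : ℕ) : ℚ) := by linarith
  set c := 1 / ((m₂.choose b : ℕ) : ℚ) with hc
  have hc0 : 0 ≤ c := by positivity
  have hcm : c * (m₂ : ℚ) ≤ 1 := by
    rw [hc, div_mul_eq_mul_div, one_mul, div_le_one hCpos]
    exact hC
  have hm₂3 : (3 : ℚ) ≤ m₂ := by exact_mod_cast (show 3 ≤ m₂ by omega)
  have hδ : coDel n j m₂ ≤ 1 / 8 := by
    have h := coDel_mul_two_pow_le hm₂j hn
    have h8 : (8 : ℚ) ≤ 2 ^ m₂ := by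
      calc (8 : ℚ) = 2 ^ 3 := by norm_num
        _ ≤ 2 ^ m₂ := pow_le_pow_right₀ (by norm_num) (by omega)
    have := coDel_nonneg n j m₂
    nlinarith
  -- `f¹_{m₁−1}·m₁·j ≤ j + 1 − m₁`
  have hL : ((j + 1 - m₁ : ℕ) : ℚ) = (j : ℚ) + 1 - m₁ := by
    rw [Nat.cast_sub (by omega)]
    push_cast
    ring
  have hr1 : (j : ℚ) ≤ ((n - j - 1 : ℕ) : ℚ) := by exact_mod_cast (show j ≤ n - j - 1 by omega)
  have hj0 : (0 : ℚ) < j := by exact_mod_cast (show 0 < j by omega)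
  have hF1' : coF n j m₁ (m₁ - 1) * ((m₁ : ℚ) * j) ≤ (j : ℚ) + 1 - m₁ := by
    rw [hL] at hF1
    have hpos : (0 : ℚ) < (m₁ : ℚ) * ((n - j - 1 : ℕ) : ℚ) := by
      apply mul_pos hm₁0
      linarith
    rw [le_div_iff₀ hpos] at hF1
    calc coF n j m₁ (m₁ - 1) * ((m₁ : ℚ) * j)
        ≤ coF n j m₁ (m₁ - 1) * ((m₁ : ℚ) * ((n - j - 1 : ℕ) : ℚ)) := by
          apply mul_le_mul_of_nonneg_left _ hF10
          apply mul_le_mul_of_nonneg_left hr1 hm₁0.le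
      _ ≤ (j : ℚ) + 1 - m₁ := hF1
  -- the margin: `(n − j)·(supR + γ) = 1 − f¹ − f²_b − G/m₁ ≥ 0`
  have hmain : 0 ≤ 1 - coF n j m₁ (m₁ - 1) - coF n j m₂ b - G / (m₁ : ℚ) := by
    have hGm : G / (m₁ : ℚ) ≤ c / (m₁ : ℚ) := div_le_div_of_nonneg_right hGle hm₁0.le
    rcases Nat.eq_or_lt_of_le hm₁ with h2 | h3
    · -- `m₁ = 2`, hence `m₂ = j`
      have hm₂j' : m₂ = j := by omega
      have hm₂jq : (m₂ : ℚ) = j := by exact_mod_cast hm₂j'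
      have hm1 : (m₁ : ℚ) = 2 := by exact_mod_cast h2.symm
      rw [hm1] at hF1' hGm ⊢
      have hcj : c * (j : ℚ) ≤ 1 := by rw [← hm₂jq]; exact hcm
      have hj3 : (3 : ℚ) ≤ j := by rw [← hm₂jq]; exact hm₂3
      have hF1'' : coF n j m₁ (m₁ - 1) * (2 * (j : ℚ)) ≤ (j : ℚ) - 1 := by linarith
      have hGle' : G ≤ c := by
        rw [hG]
        exact hGle
      -- `2j·(1 − f¹ − f² − G/2) ≥ 2j − (j − 1) − j/4 − 3 > 0`
      have key : 0 ≤ (2 * (j : ℚ)) * (1 - coF n j m₁ (m₁ - 1) - coF n j m₂ b - G / 2) := by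
        have e : (2 * (j : ℚ)) * (1 - coF n j m₁ (m₁ - 1) - coF n j m₂ b - G / 2) =
            2 * j - coF n j m₁ (m₁ - 1) * (2 * (j : ℚ)) - 2 * j * coF n j m₂ b - j * G := by ring
        rw [e]
        have h1 : 2 * (j : ℚ) * coF n j m₂ b ≤ 2 * j * (1 / 8 + c) :=
          mul_le_mul_of_nonneg_left (by linarith) (by positivity)
        have h2 : (j : ℚ) * G ≤ j * c := mul_le_mul_of_nonneg_left hGle' hj0.le
        linarith
      have key' : (2 * (j : ℚ)) * 0 ≤ (2 * (j : ℚ)) * (1 - coF n j m₁ (m₁ - 1) - coF n j m₂ b - G / 2) := by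
        rw [mul_zero]
        exact key
      exact le_of_mul_le_mul_left key' (by positivity)
    · -- `m₁ ≥ 3`: `f¹ ≤ 1/3`, `c ≤ 1/3`, `G/m₁ ≤ c/3`
      have hm₁3 : (3 : ℚ) ≤ m₁ := by exact_mod_cast h3
      have hF13 : coF n j m₁ (m₁ - 1) ≤ 1 / 3 := by
        have : coF n j m₁ (m₁ - 1) * (3 * (j : ℚ)) ≤ coF n j m₁ (m₁ - 1) * ((m₁ : ℚ) * j) := by
          apply mul_le_mul_of_nonneg_left _ hF10
          nlinarith
        have : coF n j m₁ (m₁ - 1) * (3 * (j : ℚ)) ≤ j := by linarith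
        rw [le_div_iff₀ (by norm_num)]
        nlinarith
      have hc3 : c ≤ 1 / 3 := by
        rw [le_div_iff₀ (by norm_num)]
        nlinarith
      have hGc : G / (m₁ : ℚ) ≤ c / 3 := by
        calc G / (m₁ : ℚ) ≤ c / (m₁ : ℚ) := hGm
          _ ≤ c / 3 := div_le_div_of_nonneg_left hc0 (by norm_num) hm₁3
      linarith
  have hprod : 0 ≤ ((n - j : ℕ) : ℚ) * (supR n j m₁ m₂ (m₁ - 1) b + cGamma n j m₁ m₂ b) := by
    rw [mul_add, hsup, hγ]
    have : ((n - j : ℕ) : ℚ) * (-(G / (m₁ : ℚ)) / ((n - j : ℕ) : ℚ)) = -(G / (m₁ : ℚ)) := by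
      field_simp
    rw [this]
    linarith
  by_contra hneg
  have : ((n - j : ℕ) : ℚ) * (supR n j m₁ m₂ (m₁ - 1) b + cGamma n j m₁ m₂ b) < 0 :=
    mul_neg_of_pos_of_neg hr (not_le.1 hneg)
  linarith

/-- **POSITIVITY**: every weight is nonnegative on `a < m₁`, `b < m₂`. -/
theorem w_nonneg {n j m₁ m₂ : ℕ} (hm₁ : 2 ≤ m₁) (hm₁j : m₁ ≤ j) (hm₂ : 2 ≤ m₂) (hm₂j : m₂ ≤ j)
    (hbig : j + 2 ≤ m₁ + m₂) (hn : 2 * j + 1 ≤ n) (a b : ℕ) (ha : a < m₁) (hb : b < m₂) :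
    0 ≤ wA n j m₁ m₂ a b ∧ 0 ≤ wB n j m₁ m₂ a b ∧ 0 ≤ wR n j m₁ m₂ a b := by
  have hK0 := twoK_nonneg hm₁ hm₁j hm₂ hm₂j hn
  have hm₁0 : (0 : ℚ) ≤ m₁ := by positivity
  have hm₂0 : (0 : ℚ) ≤ m₂ := by positivity
  refine ⟨?_, ?_, ?_⟩
  · unfold wA
    split_ifs
    · exact div_nonneg hK0 hm₁0
    · exact add_nonneg (supA_nonneg (by omega) hm₁j (by omega) hm₂j hn ha hb)
        (cBeta_nonneg (by omega) hm₁j hn ha.le)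
    · exact supA_nonneg (by omega) hm₁j (by omega) hm₂j hn ha hb
  · unfold wB
    split_ifs
    · exact div_nonneg hK0 hm₂0
    · exact add_nonneg (supB_nonneg (by omega) hm₁j (by omega) hm₂j hn ha hb)
        (cBeta_nonneg (by omega) hm₂j hn hb.le)
    · exact supB_nonneg (by omega) hm₁j (by omega) hm₂j hn ha hb
  · unfold wR
    split_ifs with h1 h2 h2
    · exact cornerR_nonneg hm₁ hm₁j hm₂ hm₂j hn
    · -- layer 1
      obtain rfl : a = m₁ - 1 := by omega
      rcases Nat.eq_zero_or_pos b with h0 | hpos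
      · subst h0
        have : cGamma n j m₁ m₂ 0 = 0 := by
          unfold cGamma
          simp
        rw [this, add_zero]
        exact supR_nonneg hm₁ hm₁j hm₂ hm₂j hn ha hb
      · exact layer1_R_nonneg hm₁ hm₁j hm₂ hm₂j hbig hn hpos (by omega)
    · -- layer 2: the mirror image
      obtain rfl : b = m₂ - 1 := by omega
      rw [supR_symm]
      rcases Nat.eq_zero_or_pos a with h0 | hpos
      · subst h0
        have : cGamma n j m₂ m₁ 0 = 0 := by
          unfold cGamma
          simp
        rw [this, add_zero]
        exact supR_nonneg hm₂ hm₂j hm₁ hm₁j hn hb ha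
      · exact layer1_R_nonneg hm₂ hm₂j hm₁ hm₁j (by omega) hn hpos (by omega)
    · exact supR_nonneg hm₁ hm₁j hm₂ hm₂j hn ha hb

end PercRepro.PuncturedLYM
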